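import Literature.MathematicalPhysics.QuantumFieldTheory.Balaban1983to89.B11Eq131Projection

/-!
# `Balaban1983to89.B11Eq85FirstDerivative` — T. Bałaban, *The variational problem and background fields in renormalization group method for lattice gauge theories*, Commun. Math. Phys. **102** (1985) 277–309 [Balaban1985Variational]: (85)–(90) p. 291 and (92) p. 292 — the first four termwise formulas / estimates of the functional derivative `(δ/δA′)V` (proof of Prop. 4): the operator identities (87), (89) PROVED (theorem-only module) in the abstract operator vocabulary of `B11Eq129Minimizer` / `B11Eq131Projection`, the differentiation rules (85), (88), (89), (90), (92) PROVED as Fréchet derivatives, and the constant bookkeeping of (86), (90) PROVED as real inequalities with every printed input explicit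

statement-level skeleton of published theorems with citation tags; proofs where landed; nothing here is a claim about the Yang–Mills mass gap

PDF held: `paper:balaban1985-cmp102-variational-background` (journal page = PDF page + 276).  Renders
`run/shared/lean/pub/pub-balaban/b2b-balaban-ref1/pages/1985-cmp102-variational-background/…-p015-x2.png` (p. 291) and
`…-p016-x2.png` (p. 292) READ AS IMAGES by this seat (lit-balaban reader/typer r08, gen 2, 2026-08-21); (80)–(84) p. 290
from the render-verified transcript `run/shared/lean/pub/pub-balaban/b2b-balaban-b11/transcript.md`.

CITATION HEADER (lean-in-tree rule 2026-08-18).  WHAT IS REPRODUCED: SKELETON row `B11.Eq85` = the termwise estimates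
(85)–(96) of `(δ/δA′)V`, `V(A′) = −⟨HD₃(A′), J⟩ − ⟨A′, Δ_πHD(A′)⟩ + ½⟨HD(A′), Δ_πHD(A′)⟩ + V₀(A′ − HD(A′))` (80): this
module = the first four terms (85)–(90) and the differentiation rule (92); the commutator term (91), (93)–(96) is the
sibling module `B11Eq93Commutator` (on the `ℤ^d` carrier of [6]'s modules); the gathering into Prop. 4 (97) is
`B11Smallness.prop4_gathering`; (87)'s operator identity is (137) p. 298 (`B11Eq131Projection.eq137`) tested against `A′`.

THE PRINT (p. 291 [PDF 15], verbatim).  «Let us calculate and estimate the functional derivative of each term in V(A′)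
separately. For the first term we have
  −⟨H (δ/δA′) D₃(A′), J⟩ = −Σ_{b′} η^d Σ_{c₁∈𝔅_k} (L^{j₁}η)^d tr J(b′)H(b′, c₁)𝔇₂(A′; c₁, b), (85)
and from the bound (73) it follows that
  |⟨H (δ/δA′) D₃(A′), J⟩| ≤ Σ_{y′} (L^{j′}η)^d Σ_{c₁} (L^{j₁}η)^d C₁B₃ε₁(L^{j′}η)⁻³
      · B₀e^{−δ₀d(y′,c₁,−)}(L^{j₁}η)^{−1−d} O(1)C₃ε₃²(Lʲη)^{−d+1} e^{−(1/2)δ₀d(c₁,−,y)} ≤ O(1)ε₁ε₃²(Lʲη)⁻³, b ∈ Bʲ(y), y ∈ Λ_j. (86)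
We have gathered together all the constants into an absolute constant O(1).
For the second term we have
  ⟨A′, Δ_πHD(A′)⟩ = ⟨A′, (Δ_π + DRD*)HD(A′)⟩ = ⟨A′, (G⁻¹ − Q*aQ)GQ*(QGQ*)⁻¹(L^{j(·)}η)⁻¹D(A′)⟩
    = ⟨A′, Q*(QGQ*)⁻¹(L^{j(·)}η)⁻¹D(A′)⟩ − ⟨A′, Q*a(L^{j(·)}η)⁻¹D(A′)⟩, (87)
hence the functional derivative is equal to
  Q*(QGQ*)⁻¹(L^{j(·)}η)⁻¹D(A′) − Q*a(L^{j(·)}η)⁻¹D(A′) + 𝔇*(A′)(L^{j(·)}η)⁻¹(QGQ*)⁻¹QA′ − 𝔇*(A′)(L^{j(·)}η)⁻¹aQA′. (88)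
Applying the inequalities (3.132) from [5], (55), (73), and remembering that the symbol a above represents the operator
of multiplication by (L^{j(·)}η)⁻² (we put the constant a = 1), we can estimate this functional derivative by
O(1)ε₃²(Lʲη)⁻³ on Ω_j.  The functional derivative of the third term in V(A′) is equal to
  𝔇*(A′)H*Δ_πHD(A′) = 𝔇*(A′)(L^{j(·)}η)⁻¹(QGQ*)⁻¹(L^{j(·)}η)⁻¹D(A′) [−] 𝔇*(A′)(L^{j(·)}η)⁻⁴D(A′), (89)
and can be estimated by O(1)ε₃³(Lʲη)⁻³ on Ω_j.  An analysis of the last term on the right-hand side of (80) is more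
difficult because the functional V₀ depends on derivatives DA′ also. We decompose V₀ according to the formula (39), and
we consider the functional V′₀ at first. We have
  (δ/δA′(b)) V′₀(A′ − HD(A′)) = Σ_{p∈st(b)} ((∂/∂A(b))V′₀)(A′ − HD(A′), ∂p) − 𝔇*(A′)H* Σ_{p∈st(·)} ((∂/∂A(·))V′₀)(A′ − HD(A′), ∂p), (90)
where st(b) denotes a set of plaquettes p such that b ⊂ ∂p. The derivative ((∂/∂A(b))V′₀)(A, ∂p) satisfies a bound
similar to the bound (40) for the function V′₀(A, ∂p), but with the power of |A| lower by 1, and with a different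
absolute constant. This implies that the functional derivative (90) can be estimated by O(1)ε₃²(ε₁ + ε₃)(Lʲη)⁻³ on Ω_j.»
p. 292: «The functional differentiation [of ½⟨DA′, Σi[A″, A″]⟩ (91)] gives three terms
  ½⟨DδA′, Σi[A″, A″]⟩ + ½⟨DA′, Σi([δA″, A″] + [A″, δA″])⟩, (92)».
TRANSCRIPT NOTE (89): the render shows no sign between `…(L^{j(·)}η)⁻¹D(A′)` and `𝔇*(A′)(L^{j(·)}η)⁻⁴D(A′)`; the
identity `H*Δ_πH = (L^{j(·)}η)⁻¹(QGQ*)⁻¹(L^{j(·)}η)⁻¹ − (L^{j(·)}η)⁻¹a(L^{j(·)}η)⁻¹` that (87)/(137) force has a MINUS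
there (certified below, `inner89`); we read `[−]`.

DICTIONARY (abstract; real inner-product spaces as in `B11Eq129Minimizer` / `B11Eq131Projection`, nothing re-declared).
`E` = fields `A′` on `Ω₀` with `⟨·,·⟩`; `F` = functions on `𝔅_k` (values of `Q`, of `D(A′)`, data `B`) with its
`⟨·,·⟩`; `S` = the range space of `D*` (for `R`).  `Δ` = print's `Δ_a = Δ_π + DRD* + Q*aQ` ((129); [5] (3.129)
`G = (Δ_π + DRD* + aQ*Q)⁻¹`) with right inverse `G` (`Δ(Gx) = x`), `Q`, its adjoint `Qadj` (`⟨Qx, y⟩ = ⟨x, Q*y⟩`),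
`Kinv = (QGQ*)⁻¹` (`QGQ*Kinv = 1`), `D`, `R`, `Dstar`; print's `Δ_π` is written `Δ − DRD* − Q*aQ` (the expression of `eq137`); print's `H` on
block data, `HB = GQ*(QGQ*)⁻¹(L^{j(·)}η)⁻¹B` ((45), (129)) ↦ `hOp G Qadj Kinv b` at `b = (L^{j(·)}η)⁻¹B` — the scaling
`(L^{j(·)}η)⁻¹` is absorbed into the block variable `b` (so print's `a`, «multiplication by (L^{j(·)}η)⁻²», appears as
the scalar/operator `a` on `b`, and `(L^{j(·)}η)⁻⁴ = (L^{j(·)}η)⁻¹a(L^{j(·)}η)⁻¹`); the Landau-gauge property `RD*H = 0`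
of (45) is the hypothesis `hRD`.  For the CALCULUS lemmas the nonlinear maps `D(A′)`, `D₃(A′)`, `V′₀` are arbitrary maps
with a Fréchet derivative at `A′` (`𝔇 = (δ/δA′)D` (70), `𝔇₂ = (δ/δA′)D₃`), the operators are continuous linear maps,
and «the functional derivative X of f at A′» is read as `HasFDerivAt f (δ ↦ ⟨δ, X⟩) A′` (weak form; `𝔇*`, `H*` are
thereby the adjoints inside `⟨·,·⟩`).  For the BOOKKEEPING lemmas every norm is a real variable carrying the printed
bound: (28) `|J| < C₁B₃ε₁(L^{j′}η)⁻³`, [5] Thm 3.12 `|H(b′, c₁)| ≤ B₀e^{−δ₀d}(L^{j₁}η)^{−1−d}`, (73) for the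
second-order-subtracted kernel `|𝔇₂| ≤ O(1)C₃ε₃²(Lʲη)^{−d+1}e^{−(1/2)δ₀d}`, and the two scale sums of Lemma 2.1 of [3]
(`B6.Lemma21Printed`) as the hypotheses `hL1`, `hL2` with constants `K₁`, `K₂`.

WHAT IS CERTIFIED (kernel, sorry-free; axioms `propext` / `Classical.choice` / `Quot.sound`).
§1 **(87)** (`inner87`: `⟨A′, Δ_π(Hb)⟩ = ⟨A′, Q*(QGQ*)⁻¹b⟩ − ⟨A′, Q*(a·b)⟩`, with the printed middle members
`inner87_step1`, `inner87_step2`, and the adjoint form `inner87_adj`); the operator identity of **(89)** in bilinear form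
(`inner89`: `⟨Hb₁, Δ_π(Hb₂)⟩ = ⟨b₁, (QGQ*)⁻¹b₂⟩ − ⟨b₁, a·b₂⟩`, i.e. `H*Δ_πH = (QGQ*)⁻¹ − a` on block data); the
rewriting of (88)'s last two terms through the adjoints (`eq88_adj`).  §2 the differentiation rules as `HasFDerivAt`
statements: **(85)** (`hasFDerivAt85`: `δ ↦ −⟨H𝔇₂δ, J⟩`), **(88)** (`hasFDerivAt88`: `δ ↦ ⟨δ, T D(A′)⟩ + ⟨A′, T𝔇δ⟩`
for the second term written as `⟨A′, T D(A′)⟩`, `T = Q*(QGQ*)⁻¹(·) − Q*a(·)` by (87)), **(89)** (`hasFDerivAt89`: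
the derivative of `½⟨HD(A′), MHD(A′)⟩` for symmetric `M` is `δ ↦ ⟨MHD(A′), H𝔇δ⟩`), **(90)** (`hasFDerivAt90`: chain
rule for `V′₀(A′ − HD(A′))`, derivative `δ ↦ V′₀′(δ) − V′₀′(H𝔇δ)`), **(92)** (`hasFDerivAt92`: the three terms of the
derivative of the cubic form `½P(DA′)(C(A′, A′))`).  §3 **(86)** (`ineq86`: the printed double sum, summed in the
order `c₁` then `y′` with the two Lemma-2.1 sums, is `≤ O(1)·C₁B₃B₀C₃K₁K₂·ε₁ε₃²(Lʲη)⁻³` — «gathered together … into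
an absolute constant O(1)») and **(90)'s estimate** (`ineq90`: `#st(b)·(1 + θ)` copies of the per-plaquette bound
«(40) with the power of |A| lower by 1» at `|A| ≤ 2ε₃(Lʲη)⁻¹` (57) give `≤ O(1)ε₃²(ε₁ + ε₃)(Lʲη)⁻³`).

HONEST SCOPE — what is NOT claimed.  (i) The lattice operators themselves (G, Q, H, D, 𝔇 of [5] Sect. D / Sect. C
here) are NOT constructed; (85) is certified as the chain rule in weak form, its printed KERNEL expression (the double
sum with `tr J(b′)H(b′, c₁)𝔇₂(A′; c₁, b)`) is the finite-dimensional coordinate reading and is not separately typed.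
(ii) The estimates «O(1)ε₃²(Lʲη)⁻³» of (88) and «O(1)ε₃³(Lʲη)⁻³» of (89) are NOT typed: they rest on (3.132) of [5]
(row B9, weighted-norm bounds for `Q*`, `(QGQ*)⁻¹`, `𝔇*`), whose display-level carrier is not in the tree; only their
place in the gathering (97) is (`B11Smallness.prop4_gathering`, `K₂`, `K₃`).  (iii) In `ineq86`/`ineq90` the inputs
(28), (73), [5] Thm 3.12, [3] Lemma 2.1, «(40) with the power of |A| lower by 1» and (57) are HYPOTHESES on real
variables, stated in the docstrings in print's letters; print's strict `<` are certified as `≤`.  (iv) (92) → (93)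
(«integrating by parts», i.e. `⟨DδA′, F⟩ = ⟨δA′, D*F⟩`, the definition of `D*` in [5] (3.8)–(3.9)) is not typed.
(v) Nothing here is progress on the summit `Summit.QuantumFields`.  Unit `lit-balaban-r08` gen 2 (row `B11.Eq85` of
`HOME/lit-balaban-r08/ROWS-B11.md`, HOME = `run/shared/lean/pub/lit-balaban/`).
-/

namespace Literature.MathematicalPhysics.QuantumFieldTheory.Balaban1983to89.B11Eq85FirstDerivative

open scoped InnerProductSpace
open B11Eq129Minimizer (hOp constraint_hOp inner_delta_hOp_eq_zero)
open B11Eq131Projection (eq137)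

/-! ## §1 (87), (89): operator algebra around `H = GQ*(QGQ*)⁻¹`, `Δ_π = Δ_a − DRD* − Q*aQ` -/
section OperatorAlgebra

variable {E F : Type*} [NormedAddCommGroup E] [InnerProductSpace ℝ E] [NormedAddCommGroup F]
  [InnerProductSpace ℝ F]
variable {S : Type*} [AddCommGroup S] [Module ℝ S]
variable {Δ G : E →ₗ[ℝ] E} {Q : E →ₗ[ℝ] F} {Qadj : F →ₗ[ℝ] E} {Kinv : F →ₗ[ℝ] F}

/-! Print's `Δ_π` is written throughout as `Δ − DRD* − Q*aQ` with `Δ = Δ_a = G⁻¹` ((129); [5] (3.129):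
`G = (Δ_π + DRD* + aQ*Q)⁻¹`), the expression of `B11Eq131Projection.eq137`; «`(G⁻¹ − Q*aQ)`» of (87) is `Δ_π + DRD*`. -/

variable (D : S →ₗ[ℝ] E) (R : S →ₗ[ℝ] S) (Dstar : E →ₗ[ℝ] S) (a : ℝ)

/-- (87), first equality: `⟨A′, Δ_πHb⟩ = ⟨A′, (Δ_π + DRD*)Hb⟩` — because `RD*H = 0` ((45)).
[cite: Balaban1985Variational, (87) p.291] -/
theorem inner87_step1 (b : F) (hRD : R (Dstar (hOp G Qadj Kinv b)) = 0) (A' : E) :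
    ⟪A', (Δ - D ∘ₗ R ∘ₗ Dstar - Qadj ∘ₗ (a • Q)) (hOp G Qadj Kinv b)⟫_ℝ =
      ⟪A', ((Δ - D ∘ₗ R ∘ₗ Dstar - Qadj ∘ₗ (a • Q)) + D ∘ₗ R ∘ₗ Dstar) (hOp G Qadj Kinv b)⟫_ℝ := by
  simp only [LinearMap.add_apply, LinearMap.comp_apply, hRD, map_zero, add_zero]

/-- (87), second equality: `Δ_π + DRD* = G⁻¹ − Q*aQ`, i.e. `(Δ_π + DRD*)x = Δ_a x − Q*(a·Qx)` for every `x`.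
[cite: Balaban1985Variational, (87) p.291] -/
theorem inner87_step2 (x : E) :
    ((Δ - D ∘ₗ R ∘ₗ Dstar - Qadj ∘ₗ (a • Q)) + D ∘ₗ R ∘ₗ Dstar) x = Δ x - Qadj (a • Q x) := by
  simp only [LinearMap.add_apply, LinearMap.sub_apply, LinearMap.comp_apply, LinearMap.smul_apply]
  abel

/-- **(87)** (first member = last member): for `Δ_a(Gx) = x`, `QGQ*(QGQ*)⁻¹ = 1` and `RD*(Hb) = 0`,
`⟨A′, Δ_π(Hb)⟩ = ⟨A′, Q*(QGQ*)⁻¹b⟩ − ⟨A′, Q*(a·b)⟩` — print's (87) at `b = (L^{j(·)}η)⁻¹D(A′)`; the vector identity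
behind it is (137) (`B11Eq131Projection.eq137`). [cite: Balaban1985Variational, (87) p.291] -/
theorem inner87 (hΔG : ∀ x : E, Δ (G x) = x) (hK : ∀ y : F, Q (G (Qadj (Kinv y))) = y) (b : F)
    (hRD : R (Dstar (hOp G Qadj Kinv b)) = 0) (A' : E) :
    ⟪A', (Δ - D ∘ₗ R ∘ₗ Dstar - Qadj ∘ₗ (a • Q)) (hOp G Qadj Kinv b)⟫_ℝ = ⟪A', Qadj (Kinv b)⟫_ℝ - ⟪A', Qadj (a • b)⟫_ℝ := by
  rw [eq137 hΔG hK D R Dstar a b hRD, inner_sub_right]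

/-- (87) with `Q*` moved across the scalar product: `⟨A′, Δ_π(Hb)⟩ = ⟨QA′, (QGQ*)⁻¹b⟩ − ⟨QA′, a·b⟩` — the form in
which the last two terms of (88) arise. [cite: Balaban1985Variational, (87)-(88) p.291] -/
theorem inner87_adj (hΔG : ∀ x : E, Δ (G x) = x) (hadj : ∀ (x : E) (y : F), ⟪Q x, y⟫_ℝ = ⟪x, Qadj y⟫_ℝ)
    (hK : ∀ y : F, Q (G (Qadj (Kinv y))) = y) (b : F) (hRD : R (Dstar (hOp G Qadj Kinv b)) = 0) (A' : E) :
    ⟪A', (Δ - D ∘ₗ R ∘ₗ Dstar - Qadj ∘ₗ (a • Q)) (hOp G Qadj Kinv b)⟫_ℝ = ⟪Q A', Kinv b⟫_ℝ - ⟪Q A', a • b⟫_ℝ := by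
  rw [inner87 D R Dstar a hΔG hK b hRD, ← hadj, ← hadj]

/-- **(88), last two terms**: `⟨A′, Q*(QGQ*)⁻¹Sd⟩ − ⟨A′, Q*aSd⟩ = ⟨d, S(QGQ*)⁻¹QA′⟩ − ⟨d, S(aQA′)⟩` for symmetric
`(QGQ*)⁻¹` and a symmetric scaling `S = (L^{j(·)}η)⁻¹` — i.e. the terms `𝔇*(A′)(L^{j(·)}η)⁻¹(QGQ*)⁻¹QA′ −
𝔇*(A′)(L^{j(·)}η)⁻¹aQA′` of (88) tested against `δA′` (`d = 𝔇δA′`). [cite: Balaban1985Variational, (88) p.291] -/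
theorem eq88_adj (hadj : ∀ (x : E) (y : F), ⟪Q x, y⟫_ℝ = ⟪x, Qadj y⟫_ℝ)
    (hKsymm : ∀ y z : F, ⟪Kinv y, z⟫_ℝ = ⟪y, Kinv z⟫_ℝ) (Sc : F →ₗ[ℝ] F)
    (hSsymm : ∀ y z : F, ⟪Sc y, z⟫_ℝ = ⟪y, Sc z⟫_ℝ) (A' : E) (d : F) :
    ⟪A', Qadj (Kinv (Sc d))⟫_ℝ - ⟪A', Qadj (a • Sc d)⟫_ℝ =
      ⟪d, Sc (Kinv (Q A'))⟫_ℝ - ⟪d, Sc (a • Q A')⟫_ℝ := by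
  have h1 : ⟪A', Qadj (Kinv (Sc d))⟫_ℝ = ⟪d, Sc (Kinv (Q A'))⟫_ℝ := by
    rw [← hadj, ← hKsymm, ← hSsymm, real_inner_comm]
  have h2 : ⟪A', Qadj (a • Sc d)⟫_ℝ = ⟪d, Sc (a • Q A')⟫_ℝ := by
    rw [← hadj, inner_smul_right, map_smul, inner_smul_right, ← hSsymm, real_inner_comm]
  rw [h1, h2]

/-- **(89), the operator identity** `H*Δ_πH = (L^{j(·)}η)⁻¹(QGQ*)⁻¹(L^{j(·)}η)⁻¹ − (L^{j(·)}η)⁻¹a(L^{j(·)}η)⁻¹` in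
bilinear form on block data: `⟨Hb₁, Δ_π(Hb₂)⟩ = ⟨b₁, (QGQ*)⁻¹b₂⟩ − ⟨b₁, a·b₂⟩` (`QH = 1` by (45); `RD*H = 0`).
With `b₁ = (L^{j(·)}η)⁻¹𝔇δA′`, `b₂ = (L^{j(·)}η)⁻¹D(A′)` this is the right member of (89) tested against `δA′` (see
the TRANSCRIPT NOTE on the sign). [cite: Balaban1985Variational, (89) p.291] -/
theorem inner89 (hΔG : ∀ x : E, Δ (G x) = x) (hadj : ∀ (x : E) (y : F), ⟪Q x, y⟫_ℝ = ⟪x, Qadj y⟫_ℝ)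
    (hK : ∀ y : F, Q (G (Qadj (Kinv y))) = y) (b₁ b₂ : F) (hRD : R (Dstar (hOp G Qadj Kinv b₂)) = 0) :
    ⟪hOp G Qadj Kinv b₁, (Δ - D ∘ₗ R ∘ₗ Dstar - Qadj ∘ₗ (a • Q)) (hOp G Qadj Kinv b₂)⟫_ℝ =
      ⟪b₁, Kinv b₂⟫_ℝ - ⟪b₁, a • b₂⟫_ℝ := by
  rw [inner87_adj D R Dstar a hΔG hadj hK b₂ hRD, constraint_hOp hK]

end OperatorAlgebra

/-! ## §2 The differentiation rules (85), (88), (89), (90), (92) as Fréchet derivatives (weak form) -/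
section Calculus

variable {E F : Type*} [NormedAddCommGroup E] [InnerProductSpace ℝ E] [NormedAddCommGroup F]
  [InnerProductSpace ℝ F]

/-- **(85)** (weak form): for `D₃` with Fréchet derivative `𝔇₂ = (δ/δA′)D₃` at `A′` and a continuous linear `H`,
the derivative of the first term `A′ ↦ −⟨HD₃(A′), J⟩` of (80) is `δA′ ↦ −⟨H𝔇₂δA′, J⟩` — whose coordinate expression
on the lattice is the printed double sum `−Σ_{b′}η^dΣ_{c₁}(L^{j₁}η)^d tr J(b′)H(b′, c₁)𝔇₂(A′; c₁, b)`.
[cite: Balaban1985Variational, (85) p.291] -/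
theorem hasFDerivAt85 {D₃ : E → F} {𝔇₂ : E →L[ℝ] F} {A' : E} (hD₃ : HasFDerivAt D₃ 𝔇₂ A')
    (Hc : F →L[ℝ] E) (J : E) :
    HasFDerivAt (fun X => -⟪Hc (D₃ X), J⟫_ℝ) (-((innerSL ℝ J).comp (Hc.comp 𝔇₂))) A' := by
  have h1 : HasFDerivAt (fun X => Hc (D₃ X)) (Hc.comp 𝔇₂) A' := Hc.hasFDerivAt.comp A' hD₃
  have h2 : HasFDerivAt (fun X => ⟪Hc (D₃ X), J⟫_ℝ) ((innerSL ℝ J).comp (Hc.comp 𝔇₂)) A' := by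
    refine (h1.inner ℝ (hasFDerivAt_const J A')).congr_fderiv ?_
    ext δ
    simp only [ContinuousLinearMap.comp_apply, ContinuousLinearMap.prod_apply, fderivInnerCLM_apply,
      zero_apply, inner_zero_right, zero_add, innerSL_apply_apply, real_inner_comm]
  exact h2.neg

/-- (85) evaluated: the derivative applied to `δA′` is `−⟨H𝔇₂δA′, J⟩`. [cite: Balaban1985Variational, (85) p.291] -/
theorem hasFDerivAt85_apply {𝔇₂ : E →L[ℝ] F} (Hc : F →L[ℝ] E) (J δ : E) :
    (-((innerSL ℝ J).comp (Hc.comp 𝔇₂))) δ = -⟪Hc (𝔇₂ δ), J⟫_ℝ := by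
  simp only [neg_apply, ContinuousLinearMap.comp_apply, innerSL_apply_apply, real_inner_comm]

/-- **(88)** (weak form): the second term of (80) written by (87) as `A′ ↦ ⟨A′, T D(A′)⟩` (`T = Q*(QGQ*)⁻¹(L^{j(·)}η)⁻¹
− Q*a(L^{j(·)}η)⁻¹` continuous linear, `D` with Fréchet derivative `𝔇` at `A′`) has derivative
`δA′ ↦ ⟨δA′, T D(A′)⟩ + ⟨A′, T𝔇δA′⟩` — the first two terms of (88) tested against `δA′`, plus the last two in the
form `⟨A′, Q*(…)𝔇δA′⟩` (moved onto `δA′` by `eq88_adj`). [cite: Balaban1985Variational, (88) p.291] -/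
theorem hasFDerivAt88 {Dm : E → F} {𝔇 : E →L[ℝ] F} {A' : E} (hD : HasFDerivAt Dm 𝔇 A') (T : F →L[ℝ] E) :
    HasFDerivAt (fun X => ⟪X, T (Dm X)⟫_ℝ) (innerSL ℝ (T (Dm A')) + (innerSL ℝ A').comp (T.comp 𝔇)) A' := by
  have h1 : HasFDerivAt (fun X => T (Dm X)) (T.comp 𝔇) A' := T.hasFDerivAt.comp A' hD
  refine ((hasFDerivAt_id A').inner ℝ h1).congr_fderiv ?_
  ext δ
  simp only [ContinuousLinearMap.comp_apply, ContinuousLinearMap.prod_apply, fderivInnerCLM_apply,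
    ContinuousLinearMap.id_apply, add_apply, innerSL_apply_apply, id_eq]
  rw [add_comm, real_inner_comm]

/-- (88) evaluated: the derivative applied to `δA′` is `⟨δA′, T D(A′)⟩ + ⟨A′, T𝔇δA′⟩`.
[cite: Balaban1985Variational, (88) p.291] -/
theorem hasFDerivAt88_apply {Dm : E → F} {𝔇 : E →L[ℝ] F} (T : F →L[ℝ] E) (A' δ : E) :
    (innerSL ℝ (T (Dm A')) + (innerSL ℝ A').comp (T.comp 𝔇)) δ = ⟪δ, T (Dm A')⟫_ℝ + ⟪A', T (𝔇 δ)⟫_ℝ := by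
  simp only [add_apply, ContinuousLinearMap.comp_apply, innerSL_apply_apply, real_inner_comm]

/-- **(89)** (weak form): the third term of (80), `A′ ↦ ½⟨HD(A′), MHD(A′)⟩` with `M = Δ_π` symmetric, `H` continuous
linear and `D` with Fréchet derivative `𝔇` at `A′`, has derivative `δA′ ↦ ⟨MHD(A′), H𝔇δA′⟩ = ⟨H𝔇δA′, Δ_πHD(A′)⟩`,
i.e. «𝔇*(A′)H*Δ_πHD(A′)» tested against `δA′`; `inner89` then gives the right member of (89).
[cite: Balaban1985Variational, (89) p.291] -/
theorem hasFDerivAt89 {Dm : E → F} {𝔇 : E →L[ℝ] F} {A' : E} (hD : HasFDerivAt Dm 𝔇 A') (Hc : F →L[ℝ] E)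
    (M : E →L[ℝ] E) (hM : ∀ x y : E, ⟪M x, y⟫_ℝ = ⟪x, M y⟫_ℝ) :
    HasFDerivAt (fun X => (2 : ℝ)⁻¹ * ⟪Hc (Dm X), M (Hc (Dm X))⟫_ℝ)
      ((innerSL ℝ (M (Hc (Dm A')))).comp (Hc.comp 𝔇)) A' := by
  have h1 : HasFDerivAt (fun X => Hc (Dm X)) (Hc.comp 𝔇) A' := Hc.hasFDerivAt.comp A' hD
  have h2 : HasFDerivAt (fun X => M (Hc (Dm X))) (M.comp (Hc.comp 𝔇)) A' := M.hasFDerivAt.comp A' h1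
  refine ((h1.inner ℝ h2).const_mul (2 : ℝ)⁻¹).congr_fderiv ?_
  ext δ
  simp only [smul_apply, ContinuousLinearMap.comp_apply, ContinuousLinearMap.prod_apply,
    fderivInnerCLM_apply, innerSL_apply_apply, smul_eq_mul]
  rw [← hM, real_inner_comm (M (Hc (Dm A')))]
  ring

/-- **(90)** (weak form): the chain rule for the last term `A′ ↦ V′₀(A′ − HD(A′))` of (80): with `V′₀′` the
derivative of `V′₀` at `A = A′ − HD(A′)` and `𝔇` that of `D` at `A′`, the derivative is `δA′ ↦ V′₀′(δA′) −
V′₀′(H𝔇δA′)` — print's `Σ_{p∈st(b)}((∂/∂A(b))V′₀)(A′ − HD(A′), ∂p) − 𝔇*(A′)H*Σ_{p∈st(·)}((∂/∂A(·))V′₀)(A′ − HD(A′), ∂p)`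
tested against `δA′` (the first sum is the gradient `V′₀′` in coordinates: only the plaquettes `p ∈ st(b)`, `b ⊂ ∂p`,
depend on `A(b)`). [cite: Balaban1985Variational, (90) p.291] -/
theorem hasFDerivAt90 {V₀' : E → ℝ} {dV : E →L[ℝ] ℝ} {Dm : E → F} {𝔇 : E →L[ℝ] F} {A' : E} (Hc : F →L[ℝ] E)
    (hD : HasFDerivAt Dm 𝔇 A') (hV : HasFDerivAt V₀' dV (A' - Hc (Dm A'))) :
    HasFDerivAt (fun X => V₀' (X - Hc (Dm X))) (dV.comp (ContinuousLinearMap.id ℝ E - Hc.comp 𝔇)) A' := by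
  have hT : HasFDerivAt (fun X => X - Hc (Dm X)) (ContinuousLinearMap.id ℝ E - Hc.comp 𝔇) A' :=
    (hasFDerivAt_id A').sub (Hc.hasFDerivAt.comp A' hD)
  exact hV.comp A' hT

/-- (90) evaluated: the derivative applied to `δA′` is `V′₀′(δA′) − V′₀′(H𝔇δA′)`.
[cite: Balaban1985Variational, (90) p.291] -/
theorem hasFDerivAt90_apply {dV : E →L[ℝ] ℝ} {𝔇 : E →L[ℝ] F} (Hc : F →L[ℝ] E) (δ : E) :
    (dV.comp (ContinuousLinearMap.id ℝ E - Hc.comp 𝔇)) δ = dV δ - dV (Hc (𝔇 δ)) := by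
  simp only [ContinuousLinearMap.comp_apply, sub_apply, ContinuousLinearMap.id_apply, map_sub]

/-- **(92)**: «The functional differentiation gives three terms» — for the cubic form `A′ ↦ ½P(DA′)(C(A′, A′))` of (91)
(`D` continuous linear, `C` continuous bilinear = the transported commutator sum `Σi[A″, A″]`, `P` a continuous
bilinear pairing = `⟨·,·⟩`), the derivative at `A′` is
`δA′ ↦ ½P(DδA′)(C(A′, A′)) + ½P(DA′)(C(δA′, A′) + C(A′, δA′))`. [cite: Balaban1985Variational, (92) p.292] -/
theorem hasFDerivAt92 {W : Type*} [NormedAddCommGroup W] [NormedSpace ℝ W] (Dc : E →L[ℝ] W)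
    (C : E →L[ℝ] E →L[ℝ] W) (P : W →L[ℝ] W →L[ℝ] ℝ) (A' : E) :
    HasFDerivAt (fun X => (2 : ℝ)⁻¹ * P (Dc X) (C X X))
      ((2 : ℝ)⁻¹ • ((P.flip (C A' A')).comp Dc + (P (Dc A')).comp (C.flip A' + C A'))) A' := by
  have hC : HasFDerivAt (fun X => C X X) (C.flip A' + C A') A' := by
    refine (C.hasFDerivAt_of_bilinear (hasFDerivAt_id A') (hasFDerivAt_id A')).congr_fderiv ?_
    ext δ
    simp only [add_apply, ContinuousLinearMap.precompR_apply,
      ContinuousLinearMap.precompL_apply, ContinuousLinearMap.compL_apply, ContinuousLinearMap.comp_apply,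
      ContinuousLinearMap.coe_id', ContinuousLinearMap.flip_apply, id_eq]
    rw [add_comm]
  have hP : HasFDerivAt (fun X => P (Dc X) (C X X))
      ((P.flip (C A' A')).comp Dc + (P (Dc A')).comp (C.flip A' + C A')) A' := by
    refine (P.hasFDerivAt_of_bilinear Dc.hasFDerivAt hC).congr_fderiv ?_
    ext δ
    simp only [add_apply, ContinuousLinearMap.precompR_apply,
      ContinuousLinearMap.precompL_apply, ContinuousLinearMap.compL_apply, ContinuousLinearMap.comp_apply,
      ContinuousLinearMap.flip_apply]
    rw [add_comm]
  exact hP.const_mul (2 : ℝ)⁻¹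

/-- (92) evaluated: the derivative applied to `δA′` is `½P(DδA′)(C(A′, A′)) + ½P(DA′)(C(δA′, A′) + C(A′, δA′))`.
[cite: Balaban1985Variational, (92) p.292] -/
theorem hasFDerivAt92_apply {W : Type*} [NormedAddCommGroup W] [NormedSpace ℝ W] (Dc : E →L[ℝ] W)
    (C : E →L[ℝ] E →L[ℝ] W) (P : W →L[ℝ] W →L[ℝ] ℝ) (A' δ : E) :
    ((2 : ℝ)⁻¹ • ((P.flip (C A' A')).comp Dc + (P (Dc A')).comp (C.flip A' + C A'))) δ =
      (2 : ℝ)⁻¹ * P (Dc δ) (C A' A') + (2 : ℝ)⁻¹ * P (Dc A') (C δ A' + C A' δ) := by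
  simp only [smul_apply, add_apply, ContinuousLinearMap.comp_apply,
    ContinuousLinearMap.flip_apply, map_add, smul_eq_mul]
  ring

end Calculus

/-! ## §3 The bookkeeping of (86) and of the estimate of (90) -/
section Bookkeeping

variable {Y C : Type*}

/-- **(86)**: with `w y′ = L^{j′}η > 0` (scale of the site `y′`), `v c₁ = L^{j₁}η > 0` (scale of `c₁ ∈ 𝔅_k`),
`t = Lʲη > 0`, the printed first member of (86) — `Σ_{y′}(L^{j′}η)^d Σ_{c₁}(L^{j₁}η)^d · C₁B₃ε₁(L^{j′}η)⁻³ ·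
B₀e^{−δ₀d(y′,c₁,−)}(L^{j₁}η)^{−1−d} · O(1)C₃ε₃²(Lʲη)^{−d+1}e^{−(1/2)δ₀d(c₁,−,y)}` ((28) for `|J|` on `B^{j′}(y′)`,
volume `(L^{j′}η)^d` of that block; [5] Thm 3.12 for `|H(b′, c₁)|`; (73) for `|𝔇₂(A′; c₁, b)|`) — is
`≤ O(1)·C₁B₃·B₀·C₃·K₁K₂ · ε₁ε₃²(Lʲη)⁻³`, GIVEN the two scale sums of Lemma 2.1 of [3]:
`Σ_{y′}(L^{j′}η)^{d−3}e^{−δ₀d(y′,c₁,−)} ≤ K₁(L^{j₁}η)^{d−3}` for each `c₁`, and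
`Σ_{c₁}(L^{j₁}η)^{d−4}e^{−(1/2)δ₀d(c₁,−,y)} ≤ K₂(Lʲη)^{d−4}` — «We have gathered together all the constants into an
absolute constant O(1)». [cite: Balaban1985Variational, (86) p.291] -/
theorem ineq86 (Ys : Finset Y) (Cs : Finset C) (w : Y → ℝ) (v : C → ℝ) (dYC : Y → C → ℝ) (dC : C → ℝ)
    (d : ℕ) (t C₁ B₃ ε₁ B₀ δ₀ O₁ C₃ ε₃ K₁ K₂ : ℝ)
    (hw : ∀ y ∈ Ys, 0 < w y) (hv : ∀ c ∈ Cs, 0 < v c) (ht : 0 < t)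
    (hC : 0 ≤ C₁ * B₃ * ε₁) (hB₀ : 0 ≤ B₀) (hO : 0 ≤ O₁ * C₃ * ε₃ ^ 2) (hK₁ : 0 ≤ K₁)
    (hL1 : ∀ c ∈ Cs, ∑ y ∈ Ys, w y ^ ((d : ℤ) - 3) * Real.exp (-(δ₀ * dYC y c)) ≤ K₁ * v c ^ ((d : ℤ) - 3))
    (hL2 : ∑ c ∈ Cs, v c ^ ((d : ℤ) - 4) * Real.exp (-(δ₀ / 2 * dC c)) ≤ K₂ * t ^ ((d : ℤ) - 4)) :
    ∑ y ∈ Ys, w y ^ (d : ℤ) * (C₁ * B₃ * ε₁ * w y ^ (-3 : ℤ)) *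
        ∑ c ∈ Cs, v c ^ (d : ℤ) * (B₀ * Real.exp (-(δ₀ * dYC y c)) * v c ^ (-1 - (d : ℤ))) *
          (O₁ * C₃ * ε₃ ^ 2 * t ^ (1 - (d : ℤ)) * Real.exp (-(δ₀ / 2 * dC c)))
      ≤ O₁ * C₁ * B₃ * B₀ * C₃ * K₁ * K₂ * ε₁ * ε₃ ^ 2 * t ^ (-3 : ℤ) := by
  -- the common constant
  set K : ℝ := C₁ * B₃ * ε₁ * B₀ * (O₁ * C₃ * ε₃ ^ 2) with hKdef
  have hK0 : 0 ≤ K := by rw [hKdef]; positivity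
  -- Step 1: each `(y′, c₁)` summand regrouped
  have hyc : ∀ y ∈ Ys, ∀ c ∈ Cs,
      w y ^ (d : ℤ) * (C₁ * B₃ * ε₁ * w y ^ (-3 : ℤ)) *
        (v c ^ (d : ℤ) * (B₀ * Real.exp (-(δ₀ * dYC y c)) * v c ^ (-1 - (d : ℤ))) *
          (O₁ * C₃ * ε₃ ^ 2 * t ^ (1 - (d : ℤ)) * Real.exp (-(δ₀ / 2 * dC c)))) =
      K * t ^ (1 - (d : ℤ)) *
        ((v c ^ (-1 : ℤ) * Real.exp (-(δ₀ / 2 * dC c))) *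
          (w y ^ ((d : ℤ) - 3) * Real.exp (-(δ₀ * dYC y c)))) := by
    intro y hy c hc
    have hw0 : w y ≠ 0 := (hw y hy).ne'
    have hv0 : v c ≠ 0 := (hv c hc).ne'
    have e1 : w y ^ (d : ℤ) * w y ^ (-3 : ℤ) = w y ^ ((d : ℤ) - 3) := by
      rw [← zpow_add₀ hw0]; ring_nf
    have e2 : v c ^ (d : ℤ) * v c ^ (-1 - (d : ℤ)) = v c ^ (-1 : ℤ) := by
      rw [← zpow_add₀ hv0]; ring_nf
    rw [hKdef, ← e1, ← e2]
    ring
  -- Step 2: the double sum, summed over `y′` first inside each `c₁`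
  have hsum : ∑ y ∈ Ys, w y ^ (d : ℤ) * (C₁ * B₃ * ε₁ * w y ^ (-3 : ℤ)) *
        ∑ c ∈ Cs, v c ^ (d : ℤ) * (B₀ * Real.exp (-(δ₀ * dYC y c)) * v c ^ (-1 - (d : ℤ))) *
          (O₁ * C₃ * ε₃ ^ 2 * t ^ (1 - (d : ℤ)) * Real.exp (-(δ₀ / 2 * dC c))) =
      K * t ^ (1 - (d : ℤ)) * ∑ c ∈ Cs, (v c ^ (-1 : ℤ) * Real.exp (-(δ₀ / 2 * dC c))) *
        ∑ y ∈ Ys, w y ^ ((d : ℤ) - 3) * Real.exp (-(δ₀ * dYC y c)) := by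
    simp_rw [Finset.mul_sum]
    rw [Finset.sum_comm]
    refine Finset.sum_congr rfl fun c hc => Finset.sum_congr rfl fun y hy => ?_
    rw [hyc y hy c hc]
  rw [hsum]
  -- Step 3: the inner `y′`-sum by Lemma 2.1 (`hL1`), then the `c₁`-sum by `hL2`
  have hinner : ∑ c ∈ Cs, (v c ^ (-1 : ℤ) * Real.exp (-(δ₀ / 2 * dC c))) *
        ∑ y ∈ Ys, w y ^ ((d : ℤ) - 3) * Real.exp (-(δ₀ * dYC y c)) ≤
      K₁ * ∑ c ∈ Cs, v c ^ ((d : ℤ) - 4) * Real.exp (-(δ₀ / 2 * dC c)) := by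
    rw [Finset.mul_sum]
    refine Finset.sum_le_sum fun c hc => ?_
    have hv0 : v c ≠ 0 := (hv c hc).ne'
    have hfac : 0 ≤ v c ^ (-1 : ℤ) * Real.exp (-(δ₀ / 2 * dC c)) :=
      mul_nonneg (zpow_nonneg (hv c hc).le _) (Real.exp_nonneg _)
    have e3 : v c ^ (-1 : ℤ) * v c ^ ((d : ℤ) - 3) = v c ^ ((d : ℤ) - 4) := by
      rw [← zpow_add₀ hv0]; ring_nf
    calc _ ≤ (v c ^ (-1 : ℤ) * Real.exp (-(δ₀ / 2 * dC c))) * (K₁ * v c ^ ((d : ℤ) - 3)) :=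
          mul_le_mul_of_nonneg_left (hL1 c hc) hfac
      _ = K₁ * ((v c ^ (-1 : ℤ) * v c ^ ((d : ℤ) - 3)) * Real.exp (-(δ₀ / 2 * dC c))) := by ring
      _ = K₁ * (v c ^ ((d : ℤ) - 4) * Real.exp (-(δ₀ / 2 * dC c))) := by rw [e3]
  have htd : 0 ≤ K * t ^ (1 - (d : ℤ)) := mul_nonneg hK0 (zpow_nonneg ht.le _)
  have e4 : t ^ (1 - (d : ℤ)) * t ^ ((d : ℤ) - 4) = t ^ (-3 : ℤ) := by
    rw [← zpow_add₀ ht.ne']; ring_nf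
  calc K * t ^ (1 - (d : ℤ)) * ∑ c ∈ Cs, (v c ^ (-1 : ℤ) * Real.exp (-(δ₀ / 2 * dC c))) *
        ∑ y ∈ Ys, w y ^ ((d : ℤ) - 3) * Real.exp (-(δ₀ * dYC y c))
      ≤ K * t ^ (1 - (d : ℤ)) * (K₁ * ∑ c ∈ Cs, v c ^ ((d : ℤ) - 4) * Real.exp (-(δ₀ / 2 * dC c))) :=
        mul_le_mul_of_nonneg_left hinner htd
    _ ≤ K * t ^ (1 - (d : ℤ)) * (K₁ * (K₂ * t ^ ((d : ℤ) - 4))) :=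
        mul_le_mul_of_nonneg_left (mul_le_mul_of_nonneg_left hL2 hK₁) htd
    _ = K * K₁ * K₂ * (t ^ (1 - (d : ℤ)) * t ^ ((d : ℤ) - 4)) := by ring
    _ = K * K₁ * K₂ * t ^ (-3 : ℤ) := by rw [e4]
    _ = O₁ * C₁ * B₃ * B₀ * C₃ * K₁ * K₂ * ε₁ * ε₃ ^ 2 * t ^ (-3 : ℤ) := by rw [hKdef]; ring

/-- **(90) estimated**: «The derivative ((∂/∂A(b))V′₀)(A, ∂p) satisfies a bound similar to the bound (40) for the
function V′₀(A, ∂p), but with the power of |A| lower by 1, and with a different absolute constant» — read as the third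
member of (40) with `|A|³ ↦ |A|²` and the bound `ε₂` on `Lʲη|A|` kept symbolic: `g ≤ K₀|A|²(C₁B₃ε₁ + Lʲη|A|)(Lʲη)⁻¹`,
`|A| = x`; with `A = A′ − HD(A′)`, `Lʲη|A| ≤ 2ε₃` by (57), `n = #st(b)` plaquettes in the first sum of (90) and an
operator bound `θ ≥ 0` for `𝔇*(A′)H*` on the second, the right member of (90) is
`≤ n(1 + θ)g ≤ 8n(1 + θ)K₀·max{C₁B₃, 1}·ε₃²(ε₁ + ε₃)(Lʲη)⁻³` — «can be estimated by O(1)ε₃²(ε₁ + ε₃)(Lʲη)⁻³».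
[cite: Balaban1985Variational, (90) p.291] -/
theorem ineq90 (n θ K₀ C₁B₃ ε₁ ε₃ t x g : ℝ) (ht : 0 < t) (hn : 0 ≤ n) (hθ : 0 ≤ θ) (hK₀ : 0 ≤ K₀)
    (hC : 0 ≤ C₁B₃) (hε₁ : 0 ≤ ε₁) (hx0 : 0 ≤ x) (hx : t * x ≤ 2 * ε₃)
    (hg : g ≤ K₀ * x ^ 2 * (C₁B₃ * ε₁ + t * x) / t) :
    n * (1 + θ) * g ≤ 8 * n * (1 + θ) * K₀ * max C₁B₃ 1 * ε₃ ^ 2 * (ε₁ + ε₃) / t ^ 3 := by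
  have hε₃ : 0 ≤ ε₃ := by nlinarith
  have hm1 : C₁B₃ ≤ max C₁B₃ 1 := le_max_left _ _
  have hm2 : (1 : ℝ) ≤ max C₁B₃ 1 := le_max_right _ _
  have hm0 : 0 ≤ max C₁B₃ 1 := hC.trans hm1
  -- `x ≤ 2ε₃/t`, so `x² ≤ 4ε₃²/t²`
  have hx' : x ≤ 2 * ε₃ / t := by rw [le_div_iff₀ ht]; linarith
  have hx2 : x ^ 2 ≤ (2 * ε₃ / t) ^ 2 := pow_le_pow_left₀ hx0 hx' 2
  -- `C₁B₃ε₁ + tx ≤ 2·max{C₁B₃,1}·(ε₁ + ε₃)`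
  have hlin : C₁B₃ * ε₁ + t * x ≤ 2 * max C₁B₃ 1 * (ε₁ + ε₃) := by nlinarith
  have hg' : g ≤ K₀ * (2 * ε₃ / t) ^ 2 * (2 * max C₁B₃ 1 * (ε₁ + ε₃)) / t := by
    refine hg.trans (div_le_div_of_nonneg_right ?_ ht.le)
    have h1 : K₀ * x ^ 2 * (C₁B₃ * ε₁ + t * x) ≤ K₀ * x ^ 2 * (2 * max C₁B₃ 1 * (ε₁ + ε₃)) :=
      mul_le_mul_of_nonneg_left hlin (by positivity)
    have h2 : K₀ * x ^ 2 * (2 * max C₁B₃ 1 * (ε₁ + ε₃)) ≤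
        K₀ * (2 * ε₃ / t) ^ 2 * (2 * max C₁B₃ 1 * (ε₁ + ε₃)) := by
      have : 0 ≤ 2 * max C₁B₃ 1 * (ε₁ + ε₃) := by positivity
      nlinarith [mul_le_mul_of_nonneg_left hx2 hK₀]
    exact h1.trans h2
  have e : K₀ * (2 * ε₃ / t) ^ 2 * (2 * max C₁B₃ 1 * (ε₁ + ε₃)) / t =
      8 * K₀ * max C₁B₃ 1 * ε₃ ^ 2 * (ε₁ + ε₃) / t ^ 3 := by
    field_simp
    ring
  rw [e] at hg'
  have hcoef : 0 ≤ n * (1 + θ) := by positivity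
  calc n * (1 + θ) * g ≤ n * (1 + θ) * (8 * K₀ * max C₁B₃ 1 * ε₃ ^ 2 * (ε₁ + ε₃) / t ^ 3) :=
        mul_le_mul_of_nonneg_left hg' hcoef
    _ = 8 * n * (1 + θ) * K₀ * max C₁B₃ 1 * ε₃ ^ 2 * (ε₁ + ε₃) / t ^ 3 := by ring

end Bookkeeping

end Literature.MathematicalPhysics.QuantumFieldTheory.Balaban1983to89.B11Eq85FirstDerivative
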